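import Literature.AlgebraicGeometry.Resolution.AlterationsLemma411VertexClosed
import Literature.AlgebraicGeometry.Motives.ProjectiveOfGeneratingSections
import HarnessLib

/-!
# The linear projection from the vertex `ℙ^{d+1} ∖ {vertex} → ℙ^d` as a morphism of schemes

Topic: `Literature/AlgebraicGeometry/Resolution`. Second PROVED layer under
`AlterationsLemma411Vertex.lean` (de Jong 1996, proof of Lemma 4.11, normalised at the vertex
`p = (0 : … : 0 : 1) ∈ ℙ^{d+1}_k`). There the linear projection
`pr_p : (x₀ : … : x_{d+1}) ↦ (x₀ : … : x_d)` was only given chart by chart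
(`DeJong1996.vertexProjectionChart d k i : D₊(x_i) = Spec (k[x]_{(x_i)})₀ → ℙ^d`, `i ≤ d`), and
the interface `DeJong1996.IsVertexProjection d k b q` ("`q = pr_p ∘ b` off the exceptional
locus") was stated chart by chart. This file GLUES the projection into one morphism on the
punctured space `ℙ^{d+1} ∖ {p} = ⋃_{i ≤ d} D₊(x_i)` (`DeJong1996.puncturedSpace`,
`AlterationsLemma411VertexClosed.lean`) and proves that the interface is equivalent to its
global form — the shape in which the later layers (the identification `f|_{Z'} = pr_p ∘ π|_Z`
behind "(ii) c) is clear … by construction", and the fibres `π⁻¹(ℓ)` of `f`) consume it: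

* `GeneratingSections.comapIndex` — generating-sections data (`Motives/MorphismsToProjectiveSpace`)
  with the index set cut down along `e : ι' → ι`, when the `U (e i')` still cover.
* `DeJong1996.puncturedSections d k` — the sections `x₀, …, x_d` of `𝒪(1)` on
  `ℙ^{d+1} ∖ {vertex}` (they generate exactly off the vertex): the data of the inclusion
  `ℙ^{d+1} ∖ {vertex} ↪ ℙ^{d+1}` (`GeneratingSections.ofHom`, Hartshorne II 7.1 (a)) restricted to
  the first `d + 1` coordinates.
* `DeJong1996.vertexProjection d k : ℙ^{d+1} ∖ {vertex} → ℙ^d` — **the linear projection from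
  the vertex**, the morphism of the generating sections `x₀, …, x_d` (Hartshorne II 7.1 (b),
  `GeneratingSections.toProj`); over `k` (`vertexProjection_toSpec`), with
  `pr⁻¹ D₊(y_j) = D₊(x_j) ∖ {vertex}` (`vertexProjection_preimage_basicOpen`).
* `DeJong1996.chartToPunctured d k i : Spec (k[x]_{(x_i)})₀ → ℙ^{d+1} ∖ {vertex}` — the chart
  `D₊(x_i)`, `i ≤ d`, and **`chartToPunctured_comp_vertexProjection`**: on it the global
  projection IS `vertexProjectionChart d k i` (both are the chart map through `D₊(y_i)`, whose
  ring map `(k[y]_{(y_i)})₀ → (k[x]_{(x_i)})₀` is pinned down by its values on `k` and on the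
  `y_a/y_i`, `awayRingHom_ext`).
* `DeJong1996.IsVertexProjection.preimage_ι_comp` / `.of_preimage_ι_comp` /
  `isVertexProjection_iff` — **`IsVertexProjection d k b q` ⟺
  `q|_{b⁻¹(ℙ^{d+1} ∖ {vertex})} = pr ∘ b|_{ℙ^{d+1} ∖ {vertex}}`** (one direction on the open
  cover of `b⁻¹(ℙ^{d+1} ∖ {vertex})` by the `b⁻¹ D₊(x_i) = P ×_{ℙ^{d+1}} D₊(x_i)`,
  `preimagePuncturedCover`; the other by factoring `P ×_{ℙ^{d+1}} D₊(x_i) → P` through that open).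

Spelling: as in the `ProjSpace` files of `Motives/`, `ℙ^{d+1}_k` and `ℙ^d_k` are written
`Proj k[x₀, …, x_{d+1}]`, `Proj k[y₀, …, y_d]` (`(projectiveSpace n k).left` reduces to this by
`rfl`, and morphisms typed with `projectiveSpace` are accepted by all statements below up to
this unfolding; `IsVertexProjection.fst_comp` is the chart condition re-read in this spelling).
Everything here is PROVED and [folklore] (Hartshorne II Thm. 7.1: morphisms to `ℙⁿ` from
generating sections; the coordinate description of the projection from a point).

## Sources

* R. Hartshorne, *Algebraic Geometry* (1977), II Thm. 7.1 (a), (b). [Hartshorne1977]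
* A. J. de Jong, *Smoothness, semi-stability and alterations* (1996), 2.11 (p. 56: "the
  projection morphism `pr_p` … to the projective space of lines `ℓ ⊂ ℙ^n_{k'}` passing through
  `p`") and the proof of Lemma 4.11 (p. 68). [DeJong1996]
-/

noncomputable section

open CategoryTheory CategoryTheory.Limits AlgebraicGeometry TopologicalSpace HomogeneousLocalization

attribute [local instance] MvPolynomial.gradedAlgebra

namespace Literature.AlgebraicGeometry.Resolution

universe u

open Literature.AlgebraicGeometry.Motives (projectiveSpace)
open Literature.AlgebraicGeometry.Motives.Segre (grading cst frac chartι toSpec X_mem)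

/-! ## Generating sections with fewer indices -/

/-- **Restricting the index set of generating-sections data** along a map `e : ι' → ι` whose
opens `U (e i')` still cover: the sub-family `(s_{e i'})` of a generating family is generating as
soon as its non-vanishing loci cover. [folklore] -/
def _root_.Literature.AlgebraicGeometry.Motives.GeneratingSections.comapIndex {ι ι' : Type}
    {Y : Scheme.{u}} (D : Literature.AlgebraicGeometry.Motives.GeneratingSections ι Y)
    (e : ι' → ι) (h : ⨆ i', D.U (e i') = ⊤) :
    Literature.AlgebraicGeometry.Motives.GeneratingSections ι' Y where
  U i' := D.U (e i')
  iSup_U := h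
  ratio i' j' := D.ratio (e i') (e j')
  ratio_self i' := D.ratio_self (e i')
  basicOpen_ratio i' j' := D.basicOpen_ratio (e i') (e j')
  ratio_mul_ratio i' j' l' := D.ratio_mul_ratio (e i') (e j') (e l')

/-! ## The projection from the vertex on the punctured space -/

namespace DeJong1996

variable (d : ℕ) (k : Type u) [Field k]

open Literature.AlgebraicGeometry.Motives (GeneratingSections)
open Literature.AlgebraicGeometry.Motives.Segre (pull pull_comp pull_SpecMap' toSpecΓ_SpecMap_pull)

/-- The generating sections `x₀, …, x_d` of `𝒪(1)` on the punctured space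
`ℙ^{d+1} ∖ {vertex} = ⋃_{i ≤ d} D₊(x_i)` (they generate exactly off the vertex): the
generating-sections data of the inclusion `ℙ^{d+1} ∖ {vertex} ↪ ℙ^{d+1}`
(`GeneratingSections.ofHom`: opens `D₊(x_l) ∖ {vertex}`, ratios `x_j/x_l`) with the index set cut
down to `x₀, …, x_d`. [folklore] -/
def puncturedSections :
    GeneratingSections (Fin (d + 1)) (puncturedSpace d k : Scheme.{u}) :=
  (GeneratingSections.ofHom (puncturedSpace d k).ι).comapIndex Fin.castSucc (by
    rw [← top_le_iff]
    intro x _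
    rw [Opens.mem_iSup]
    obtain ⟨i, hi⟩ := Opens.mem_iSup.1 (show (puncturedSpace d k).ι x ∈ puncturedSpace d k from
      x.2)
    exact ⟨i, hi⟩)

/-- **The linear projection from the vertex** `pr : ℙ^{d+1}_k ∖ {vertex} → ℙ^d_k`,
`(x₀ : … : x_{d+1}) ↦ (x₀ : … : x_d)`: the morphism to `ℙ^d = Proj k[y₀, …, y_d]` defined by the
generating sections `x₀, …, x_d` (Hartshorne II Thm. 7.1; `GeneratingSections.toProj`).
[folklore] -/
def vertexProjection : (puncturedSpace d k : Scheme.{u}) ⟶ Proj (grading (Fin (d + 1)) k) :=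
  (puncturedSections d k).toProj ((puncturedSpace d k).ι ≫ toSpec (Fin (d + 1 + 1)) k)

/-- The projection from the vertex is a morphism over `k`. [folklore] -/
theorem vertexProjection_toSpec :
    vertexProjection d k ≫ toSpec (Fin (d + 1)) k =
      (puncturedSpace d k).ι ≫ toSpec (Fin (d + 1 + 1)) k :=
  (puncturedSections d k).toProj_toSpec _

/-- **`pr⁻¹ D₊(y_j) = D₊(x_j) ∖ {vertex}`** (`j ≤ d`). [folklore] -/
theorem vertexProjection_preimage_basicOpen (j : Fin (d + 1)) :
    vertexProjection d k ⁻¹ᵁ Proj.basicOpen (grading (Fin (d + 1)) k) (MvPolynomial.X j) =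
      (puncturedSpace d k).ι ⁻¹ᵁ
        Proj.basicOpen (grading (Fin (d + 1 + 1)) k) (MvPolynomial.X (Fin.castSucc j)) :=
  (puncturedSections d k).toProj_preimage_basicOpen _ j

/-! ### The projection on the charts `D₊(x_i)`, `i ≤ d` -/

/-- The chart `Spec (k[x]_{(x_i)})₀ = D₊(x_i)`, `i ≤ d`, as an open subscheme of the open
`D₊(x_i) ∖ {vertex} = D₊(x_i)` of the punctured space (lifting Mathlib's `Proj.awayι`).
[folklore] -/
def chartToPreimage (i : Fin (d + 1)) :
    Spec (.of (Away (grading (Fin (d + 1 + 1)) k) (MvPolynomial.X (Fin.castSucc i)))) ⟶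
      ↑((puncturedSpace d k).ι ⁻¹ᵁ
        Proj.basicOpen (grading (Fin (d + 1 + 1)) k) (MvPolynomial.X (Fin.castSucc i))) :=
  IsOpenImmersion.lift
    (((puncturedSpace d k).ι ⁻¹ᵁ
        Proj.basicOpen (grading (Fin (d + 1 + 1)) k) (MvPolynomial.X (Fin.castSucc i))).ι ≫
      (puncturedSpace d k).ι)
    (chartι k (Fin.castSucc i)) (by
      rintro _ ⟨t, rfl⟩
      have ht : chartι k (Fin.castSucc i) t ∈
          Proj.basicOpen (grading (Fin (d + 1 + 1)) k) (MvPolynomial.X (Fin.castSucc i)) := by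
        have h : chartι k (Fin.castSucc i) t ∈ (chartι k (Fin.castSucc i)).opensRange := ⟨t, rfl⟩
        rwa [Proj.opensRange_awayι] at h
      have hW : chartι k (Fin.castSucc i) t ∈ puncturedSpace d k :=
        basicOpen_le_puncturedSpace d k i ht
      exact ⟨⟨⟨_, hW⟩, ht⟩, rfl⟩)

/-- The lifted chart composed with the two inclusions is the chart `D₊(x_i) ↪ ℙ^{d+1}`.
[folklore] -/
@[reassoc]
theorem chartToPreimage_ι_ι (i : Fin (d + 1)) :
    chartToPreimage d k i ≫
        ((puncturedSpace d k).ι ⁻¹ᵁ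
          Proj.basicOpen (grading (Fin (d + 1 + 1)) k) (MvPolynomial.X (Fin.castSucc i))).ι ≫
      (puncturedSpace d k).ι = chartι k (Fin.castSucc i) :=
  IsOpenImmersion.lift_fac _ _ _

/-- **The chart `D₊(x_i) ↪ ℙ^{d+1} ∖ {vertex}`**, `i ≤ d`, as a morphism
`Spec (k[x]_{(x_i)})₀ → ℙ^{d+1} ∖ {vertex}`. [folklore] -/
def chartToPunctured (i : Fin (d + 1)) :
    Spec (.of (Away (grading (Fin (d + 1 + 1)) k) (MvPolynomial.X (Fin.castSucc i)))) ⟶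
      (puncturedSpace d k : Scheme.{u}) :=
  chartToPreimage d k i ≫
    ((puncturedSpace d k).ι ⁻¹ᵁ
      Proj.basicOpen (grading (Fin (d + 1 + 1)) k) (MvPolynomial.X (Fin.castSucc i))).ι

/-- `chartToPunctured i` followed by the inclusion is the chart `D₊(x_i) ↪ ℙ^{d+1}`. [folklore] -/
@[reassoc]
theorem chartToPunctured_ι (i : Fin (d + 1)) :
    chartToPunctured d k i ≫ (puncturedSpace d k).ι = chartι k (Fin.castSucc i) := by
  rw [chartToPunctured, Category.assoc, chartToPreimage_ι_ι]

end DeJong1996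

/-! ## The global projection restricts to the chart projections -/

namespace DeJong1996

variable (d : ℕ) (k : Type u) [Field k]

open Literature.AlgebraicGeometry.Motives (GeneratingSections)
open Literature.AlgebraicGeometry.Motives.Segre (pull pull_comp pull_SpecMap' pull_SpecMap
  toSpecΓ_SpecMap_pull awayMk_eq_eval₂)

/-- Two ring maps out of `(k[x]_{(x_i)})₀` which agree on the constants and on the generators
`x_a/x_i` agree (every element is a polynomial in the `x_a/x_i`, `awayMk_eq_eval₂`). [folklore] -/
theorem awayRingHom_ext {ι : Type} {B : Type u} [CommRing B] {i : ι}
    {φ ψ : Away (grading ι k) (MvPolynomial.X i) →+* B}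
    (hc : φ.comp (cst k (MvPolynomial.X i)) = ψ.comp (cst k (MvPolynomial.X i)))
    (hf : ∀ a, φ (frac k i a) = ψ (frac k i a)) : φ = ψ := by
  refine RingHom.ext fun s => ?_
  obtain ⟨n, p, hp, rfl⟩ := Away.mk_surjective (grading ι k) (X_mem k i) s
  rw [awayMk_eq_eval₂, MvPolynomial.map_eval₂Hom, MvPolynomial.map_eval₂Hom, hc]
  congr 2
  funext a
  exact hf a

/-- Pulling back along `Spec F : Spec S → Spec R` is pulling back along the identity of `Spec S`
after `F`. [folklore] -/
theorem pull_SpecMap_id {R S : CommRingCat.{u}} (F : R ⟶ S) :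
    pull (Spec.map F) = (pull (𝟙 (Spec S))).comp F.hom := by
  rw [← pull_SpecMap', Category.id_comp]

/-- Restricting along `V.ι` a section of `V` read through `V.topIso` gives it back. [folklore] -/
theorem res_ι_topIso_hom {Y : Scheme.{u}} (V : Y.Opens) (h : ⊤ ≤ V.ι ⁻¹ᵁ V)
    (t : Γ(↑V, ⊤)) : GeneratingSections.res V.ι V h (V.topIso.hom t) = t := by
  simp only [GeneratingSections.res, Scheme.Opens.topIso_hom, Scheme.Opens.ι_appLE]
  erw [← CommRingCat.comp_apply, ← Y.presheaf.map_comp]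
  exact (congrArg (fun θ => (Y.presheaf.map θ) t) (Subsingleton.elim _ (𝟙 _))).trans
    (by rw [Y.presheaf.map_id]; rfl)

/-- **The global projection from the vertex restricts to the chart projections**: on
`D₊(x_i) = Spec (k[x]_{(x_i)})₀`, `i ≤ d`, `vertexProjection` is `vertexProjectionChart d k i`
(`Spec` of `y_a/y_i ↦ x_a/x_i` followed by `D₊(y_i) ↪ ℙ^d`) — both are the chart map of the
generating sections through `D₊(y_i)` (`GeneratingSections.comp_toProj`), whose ring map is
determined by its values on constants and on the `y_a/y_i`. [folklore] -/
theorem chartToPunctured_comp_vertexProjection (i : Fin (d + 1)) :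
    chartToPunctured d k i ≫ vertexProjection d k = vertexProjectionChart d k i := by
  set V : (puncturedSpace d k : Scheme.{u}).Opens := (puncturedSpace d k).ι ⁻¹ᵁ
    Proj.basicOpen (grading (Fin (d + 1 + 1)) k) (MvPolynomial.X (Fin.castSucc i)) with hV
  have hV0 : ⊤ ≤ V.ι ⁻¹ᵁ (puncturedSections d k).U i := GeneratingSections.top_le_ι_preimage V
  have hg : ⊤ ≤ (chartToPreimage d k i ≫ V.ι) ⁻¹ᵁ (puncturedSections d k).U i := by
    rw [Scheme.Hom.comp_preimage]
    exact le_top.trans (Scheme.Hom.preimage_mono _ hV0)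
  -- the chart lands in `V` and is a section of `chartLift`
  have hid : chartToPreimage d k i ≫
      GeneratingSections.chartLift (puncturedSpace d k).ι (Fin.castSucc i) = 𝟙 _ := by
    rw [← cancel_mono (chartι k (Fin.castSucc i)), Category.assoc,
      GeneratingSections.chartLift_chartι, Category.id_comp]
    exact chartToPreimage_ι_ι d k i
  change (chartToPreimage d k i ≫ V.ι) ≫ vertexProjection d k = _
  rw [vertexProjection, GeneratingSections.comp_toProj _ _ _ hg, GeneratingSections.chartMap,
    vertexProjectionChart, ← Category.assoc]
  congr 1
  have key : (puncturedSections d k).chartRingHom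
      ((puncturedSpace d k).ι ≫ toSpec (Fin (d + 1 + 1)) k) i (chartToPreimage d k i ≫ V.ι) hg =
      pull (Spec.map (CommRingCat.ofHom (vertexProjectionRingHom d k i))) := by
    apply awayRingHom_ext k
    · rw [GeneratingSections.chartRingHom_comp_cst, pull_SpecMap_id, RingHom.comp_assoc,
        CommRingCat.hom_ofHom, vertexProjectionRingHom_comp_cst, Category.assoc,
        chartToPreimage_ι_ι_assoc, Literature.AlgebraicGeometry.Motives.Segre.chartι_toSpec,
        pull_SpecMap_id, CommRingCat.hom_ofHom]
    · intro a
      rw [GeneratingSections.chartRingHom_frac, pull_SpecMap_id, RingHom.comp_apply,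
        CommRingCat.hom_ofHom, vertexProjectionRingHom_frac,
        GeneratingSections.res_comp V.ι ((puncturedSections d k).U i) hV0 (chartToPreimage d k i)
          hg, RingHom.comp_apply]
      change (chartToPreimage d k i).appTop (GeneratingSections.res V.ι V hV0
        (V.topIso.hom (pull (GeneratingSections.chartLift (puncturedSpace d k).ι
          (Fin.castSucc i)) (frac k (Fin.castSucc i) (Fin.castSucc a))))) = _
      rw [res_ι_topIso_hom, ← RingHom.comp_apply, ← pull_comp, hid]
  rw [key, toSpecΓ_SpecMap_pull]

end DeJong1996

/-! ## `IsVertexProjection` in global form -/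

namespace DeJong1996

variable (d : ℕ) (k : Type u) [Field k]

/-- The chart condition of `IsVertexProjection`, read with `ℙ^{d+1}`, `ℙ^d` in the `Proj`
spelling (to which `(projectiveSpace n k).left` reduces by `rfl`). [folklore] -/
theorem IsVertexProjection.fst_comp {P : Scheme.{u}} {b : P ⟶ Proj (grading (Fin (d + 1 + 1)) k)}
    {q : P ⟶ Proj (grading (Fin (d + 1)) k)} (h : IsVertexProjection d k b q) (i : Fin (d + 1)) :
    pullback.fst b (chartι k (Fin.castSucc i)) ≫ q =
      pullback.snd b (chartι k (Fin.castSucc i)) ≫ vertexProjectionChart d k i :=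
  h.pullback_fst_comp i

/-- The open immersions `b⁻¹ D₊(x_i) = P ×_{ℙ^{d+1}} D₊(x_i) ↪ b⁻¹(ℙ^{d+1} ∖ {vertex})`, `i ≤ d`.
[folklore] -/
def preimagePuncturedCoverMap {P : Scheme.{u}} (b : P ⟶ Proj (grading (Fin (d + 1 + 1)) k))
    (i : Fin (d + 1)) :
    pullback b (chartι k (Fin.castSucc i)) ⟶ (↑(b ⁻¹ᵁ puncturedSpace d k) : Scheme.{u}) :=
  IsOpenImmersion.lift (b ⁻¹ᵁ puncturedSpace d k).ι (pullback.fst b (chartι k (Fin.castSucc i)))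
    (by
      rw [Scheme.Pullback.range_fst, Scheme.Opens.range_ι]
      rintro x ⟨t, ht⟩
      have hmem : chartι k (Fin.castSucc i) t ∈ puncturedSpace d k := by
        have h : chartι k (Fin.castSucc i) t ∈ (chartι k (Fin.castSucc i)).opensRange :=
          ⟨t, rfl⟩
        rw [Proj.opensRange_awayι] at h
        exact basicOpen_le_puncturedSpace d k i h
      change b x ∈ puncturedSpace d k
      rw [← ht]
      exact hmem)

/-- The maps `preimagePuncturedCoverMap` are open immersions (lifts of the base change of the
open immersion `D₊(x_i) ↪ ℙ^{d+1}`). [folklore] -/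
instance isOpenImmersion_preimagePuncturedCoverMap {P : Scheme.{u}}
    (b : P ⟶ Proj (grading (Fin (d + 1 + 1)) k)) (i : Fin (d + 1)) :
    IsOpenImmersion (preimagePuncturedCoverMap d k b i) := by
  unfold preimagePuncturedCoverMap
  infer_instance

/-- `preimagePuncturedCoverMap i` composed with the inclusion is the first projection.
[folklore] -/
@[reassoc]
theorem preimagePuncturedCoverMap_ι {P : Scheme.{u}} (b : P ⟶ Proj (grading (Fin (d + 1 + 1)) k))
    (i : Fin (d + 1)) :
    preimagePuncturedCoverMap d k b i ≫ (b ⁻¹ᵁ puncturedSpace d k).ι =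
      pullback.fst b (chartι k (Fin.castSucc i)) :=
  IsOpenImmersion.lift_fac _ _ _

/-- The `b⁻¹ D₊(x_i)`, `i ≤ d`, cover `b⁻¹(ℙ^{d+1} ∖ {vertex})`. [folklore] -/
theorem exists_preimagePuncturedCoverMap_apply_eq {P : Scheme.{u}}
    (b : P ⟶ Proj (grading (Fin (d + 1 + 1)) k)) (x : ↥(b ⁻¹ᵁ puncturedSpace d k)) :
    ∃ (i : Fin (d + 1)) (y : ↥(pullback b (chartι k (Fin.castSucc i)))),
      preimagePuncturedCoverMap d k b i y = x := by
  obtain ⟨i, hi⟩ := Opens.mem_iSup.1 (show b x.1 ∈ puncturedSpace d k from x.2)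
  rw [← Proj.opensRange_awayι _ _ (X_mem k (Fin.castSucc i)) zero_lt_one] at hi
  obtain ⟨y, hy⟩ : x.1 ∈ Set.range (pullback.fst b (chartι k (Fin.castSucc i))) := by
    rw [Scheme.Pullback.range_fst]
    exact hi
  refine ⟨i, y, ?_⟩
  apply (b ⁻¹ᵁ puncturedSpace d k).ι.injective
  rw [← Scheme.Hom.comp_apply, preimagePuncturedCoverMap_ι]
  exact hy

/-- The open cover of `b⁻¹(ℙ^{d+1} ∖ {vertex})` by the `b⁻¹ D₊(x_i) = P ×_{ℙ^{d+1}} D₊(x_i)`,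
`i ≤ d` (a structure literal, so that its index type is `Fin (d + 1)` reducibly). [folklore] -/
abbrev preimagePuncturedCover {P : Scheme.{u}} (b : P ⟶ Proj (grading (Fin (d + 1 + 1)) k)) :
    (↑(b ⁻¹ᵁ puncturedSpace d k) : Scheme.{u}).OpenCover where
  I₀ := Fin (d + 1)
  X i := pullback b (chartι k (Fin.castSucc i))
  f i := preimagePuncturedCoverMap d k b i
  mem₀ := (Scheme.Cover.mkOfCovers (Fin (d + 1)) (fun i => pullback b (chartι k (Fin.castSucc i)))
    (preimagePuncturedCoverMap d k b) (exists_preimagePuncturedCoverMap_apply_eq d k b)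
    (fun i => by infer_instance)).mem₀

/-- **`IsVertexProjection` globally: off the exceptional locus, `q` is `b` followed by the linear
projection from the vertex** — `q|_{b⁻¹(ℙ^{d+1} ∖ {vertex})} = pr ∘ b|_{ℙ^{d+1} ∖ {vertex}}`
(checked on the cover by the `b⁻¹ D₊(x_i)`, `i ≤ d`, where it is the defining chart condition,
`chartToPunctured_comp_vertexProjection`); `ℙ^{d+1}`, `ℙ^d` in the `Proj` spelling. [folklore] -/
theorem IsVertexProjection.preimage_ι_comp {P : Scheme.{u}}
    {b : P ⟶ Proj (grading (Fin (d + 1 + 1)) k)} {q : P ⟶ Proj (grading (Fin (d + 1)) k)}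
    (h : IsVertexProjection d k b q) :
    (b ⁻¹ᵁ puncturedSpace d k).ι ≫ q = (b ∣_ puncturedSpace d k) ≫ vertexProjection d k := by
  refine Scheme.Cover.hom_ext (preimagePuncturedCover d k b) _ _ fun i => ?_
  change preimagePuncturedCoverMap d k b i ≫ _ = preimagePuncturedCoverMap d k b i ≫ _
  rw [← Category.assoc, preimagePuncturedCoverMap_ι, h.fst_comp d k i,
    ← chartToPunctured_comp_vertexProjection, ← Category.assoc, ← Category.assoc]
  congr 1
  rw [← cancel_mono (puncturedSpace d k).ι, Category.assoc, chartToPunctured_ι, Category.assoc,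
    morphismRestrict_ι, ← Category.assoc, preimagePuncturedCoverMap_ι, pullback.condition]

end DeJong1996

namespace DeJong1996

variable (d : ℕ) (k : Type u) [Field k]

/-- `preimagePuncturedCoverMap i` followed by `b|_{ℙ ∖ vertex}` is the second projection followed
by the chart `D₊(x_i) ↪ ℙ^{d+1} ∖ {vertex}`. [folklore] -/
@[reassoc]
theorem preimagePuncturedCoverMap_morphismRestrict {P : Scheme.{u}}
    (b : P ⟶ Proj (grading (Fin (d + 1 + 1)) k)) (i : Fin (d + 1)) :
    preimagePuncturedCoverMap d k b i ≫ (b ∣_ puncturedSpace d k) =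
      pullback.snd b (chartι k (Fin.castSucc i)) ≫ chartToPunctured d k i := by
  rw [← cancel_mono (puncturedSpace d k).ι, Category.assoc, morphismRestrict_ι,
    preimagePuncturedCoverMap_ι_assoc, pullback.condition, Category.assoc, chartToPunctured_ι]

/-- **The global form implies the chart conditions**: if `q|_{b⁻¹(ℙ^{d+1} ∖ {vertex})}` is
`pr ∘ b|`, then `(b, q)` satisfies `IsVertexProjection` (so the latter may be established from
the former, e.g. for the incidence variety). [folklore] -/
theorem IsVertexProjection.of_preimage_ι_comp {P : Scheme.{u}}
    {b : P ⟶ Proj (grading (Fin (d + 1 + 1)) k)} {q : P ⟶ Proj (grading (Fin (d + 1)) k)}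
    (h : (b ⁻¹ᵁ puncturedSpace d k).ι ≫ q = (b ∣_ puncturedSpace d k) ≫ vertexProjection d k) :
    IsVertexProjection d k b q where
  pullback_fst_comp i := by
    change pullback.fst b (chartι k (Fin.castSucc i)) ≫ q =
      pullback.snd b (chartι k (Fin.castSucc i)) ≫ vertexProjectionChart d k i
    rw [← preimagePuncturedCoverMap_ι, Category.assoc, h,
      preimagePuncturedCoverMap_morphismRestrict_assoc, chartToPunctured_comp_vertexProjection]

/-- `IsVertexProjection` is equivalent to its global form. [folklore] -/
theorem isVertexProjection_iff {P : Scheme.{u}}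
    (b : P ⟶ Proj (grading (Fin (d + 1 + 1)) k)) (q : P ⟶ Proj (grading (Fin (d + 1)) k)) :
    IsVertexProjection d k b q ↔
      (b ⁻¹ᵁ puncturedSpace d k).ι ≫ q = (b ∣_ puncturedSpace d k) ≫ vertexProjection d k :=
  ⟨fun h => h.preimage_ι_comp d k, IsVertexProjection.of_preimage_ι_comp d k⟩

end DeJong1996


end Literature.AlgebraicGeometry.Resolution

end
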